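import Summits.QuantumFields.YangMills.Theorems.ColdStartUniversalityLatticeLangevinKernelActionContinuity
import HarnessLib

/-!
# Route `ColdStartUniversality` (fixed-cut-off package, sampler statistics): the `L²` CORE OF LEZAUD'S CHERNOFF BOUND —
# norm of the symmetric Feynman–Kac sandwich `f ↦ w · P(w f)` from its quadratic form, and the form bound from a spectral gap

Helper file (seat `ym-line-csu-p1`, g37; `--supports stmt-QuantumFields-24809`).  ABSTRACT measure theory (no SZZ object), in the
toolkit namespace `…ColdStartUniversality.FeynmanKac`.  Setting: a probability (or finite) measure `μ` on `X`, a Markov kernel `P` on `X`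
which is SYMMETRIC on bounded measurable functions (`∫ f·Pg dμ = ∫ g·Pf dμ`) and POSITIVE (`∫ g·Pg dμ ≥ 0`), and a bounded measurable
weight `w` (in the application `w = exp(θhV/2)`, `P = κ_h` the time-`h` transition kernel of the SU(2) lattice Langevin dynamics).  The
discrete Feynman–Kac functional `E[exp(θh Σ_{k<n} V(X_{kh}))]` of the `h`-skeleton chain is governed by the sandwich operator
`S f = w · P(w f)`; this file proves the two operator-free facts that replace the spectral theorem in Lezaud's argument:

* `sq_integral_mul_le` — Cauchy–Schwarz `(∫ φg dμ)² ≤ ∫φ² dμ · ∫g² dμ` for bounded measurable `φ, g` (discriminant);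
* ★★ `integral_sq_sandwich_le` — **NORM FROM FORM**: if `∫ (wg)·P(wg) dμ ≤ m ∫ g² dμ` for all bounded measurable `g`, then
  `∫ (w·P(wf))² dμ ≤ m² ∫ f² dμ` for all bounded measurable `f` (Cauchy–Schwarz for the positive symmetric bilinear form
  `(u,v) ↦ ∫ (wu)·P(wv) dμ` via `discrim_le_zero`; no Hilbert-space structure, no self-adjoint operator theory);
* ★★ `integral_sq_sandwich_iterate_le` — hence `∫ (Sᵏ f)² dμ ≤ m^{2k} ∫ f² dμ` (with `sandwich_iterate_measurable_abs_le`);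
* ★★★ `lezaud_form_bound` — **THE FORM BOUND FROM A GAP** (Lezaud's perturbation estimate in quadratic-form clothing): for a
  probability measure `μ`, `V` bounded measurable with `|V| ≤ b`, `∫V dμ = 0`, `∫V² dμ ≤ σ²` (`σ > 0`), `0 ≤ ε` with `εb ≤ 1`,
  `r ∈ [0,1]` with `c := 1 − r − rεb > 0`, and every bounded measurable `g`:
  `r ∫ e^{εV} g² dμ + (1 − r)(∫ e^{εV/2} g dμ)² ≤ (1 + r²ε²σ²/c + r(εb)² + 3(1 − r)εb) ∫ g² dμ`
  — with `r = e^{−λh}`, `ε = θh` the right-hand constant is `1 + h·θ²σ²/(λ − θb) + O(h²)` (`lezaud_rate_bound`), i.e. the top of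
  the spectrum of `L + θV` is at most `θ²σ²/(λ − θb)` [Lezaud 2001, proof of Thm 1.1 / Remark 1.2].

THEOREMS ONLY, no definition, no sorry.  HONEST FRAMING: abstract `L²` bookkeeping for the fixed-cut-off sampler package; nothing here is
specific to Yang–Mills, nothing is uniform in any cut-off; no crux, rung or summit statement is proved; the Yang–Mills mass gap is NOT proved.
-/

set_option autoImplicit false

noncomputable section

namespace Summit.QuantumFields.YangMills.Theorems.ColdStartUniversality.FeynmanKac

open MeasureTheory ProbabilityTheory Filter Set
open scoped BigOperators NNReal ENNReal

variable {X : Type*} [MeasurableSpace X]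

/-! ## §0. Bookkeeping: bounded measurable functions and kernel actions -/

/-- A bounded measurable real function is integrable for a finite measure. [folklore] -/
theorem integrable_of_measurable_of_abs_le (ρ : Measure X) [IsFiniteMeasure ρ] {g : X → ℝ} (hg : Measurable g)
    {B : ℝ} (hB : ∀ y, |g y| ≤ B) : Integrable g ρ :=
  Integrable.of_bound hg.aestronglyMeasurable B (ae_of_all _ fun y => by rw [Real.norm_eq_abs]; exact hB y)

/-- The action `x ↦ ∫ g dP(x)` of a kernel on a measurable real function is measurable. [folklore] -/
theorem measurable_kernel_integral (P : Kernel X X) {g : X → ℝ} (hg : Measurable g) :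
    Measurable fun x => ∫ y, g y ∂(P x) :=
  (hg.stronglyMeasurable.integral_kernel (κ := P)).measurable

/-- The action of a Markov kernel preserves a uniform bound: `|∫ g dP(x)| ≤ B` if `|g| ≤ B`. [folklore] -/
theorem abs_kernel_integral_le (P : Kernel X X) [IsMarkovKernel P] {g : X → ℝ} {B : ℝ} (hB : ∀ y, |g y| ≤ B) (x : X) :
    |∫ y, g y ∂(P x)| ≤ B :=
  abs_integral_le_of_abs_le_of_isProbabilityMeasure (μ := P x) hB

omit [MeasurableSpace X] in
/-- Product of two bounded functions is bounded by the product of the bounds. [folklore] -/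
theorem abs_mul_le_of_abs_le {u v : X → ℝ} {A B : ℝ} (hu : ∀ x, |u x| ≤ A) (hv : ∀ x, |v x| ≤ B) (x : X) :
    |u x * v x| ≤ A * B := by
  rw [abs_mul]
  exact mul_le_mul (hu x) (hv x) (abs_nonneg _) ((abs_nonneg _).trans (hu x))

/-! ## §1. Cauchy–Schwarz for integrals of bounded measurable functions -/

/-- **Cauchy–Schwarz**: `(∫ φ·g dρ)² ≤ (∫ φ² dρ)(∫ g² dρ)` for bounded measurable `φ, g` and a finite measure `ρ` (the quadratic
`t ↦ ∫ (tφ − g)² dρ ≥ 0` has non-positive discriminant). [folklore] -/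
theorem sq_integral_mul_le (ρ : Measure X) [IsFiniteMeasure ρ] {φ g : X → ℝ} (hφ : Measurable φ) {Bφ : ℝ}
    (hBφ : ∀ x, |φ x| ≤ Bφ) (hg : Measurable g) {Bg : ℝ} (hBg : ∀ x, |g x| ≤ Bg) :
    (∫ x, φ x * g x ∂ρ) ^ 2 ≤ (∫ x, φ x ^ 2 ∂ρ) * ∫ x, g x ^ 2 ∂ρ := by
  have iφ2 : Integrable (fun x => φ x ^ 2) ρ :=
    integrable_of_measurable_of_abs_le ρ (hφ.pow_const 2) (B := Bφ ^ 2) fun x => by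
      rw [abs_pow]; exact pow_le_pow_left₀ (abs_nonneg _) (hBφ x) 2
  have ig2 : Integrable (fun x => g x ^ 2) ρ :=
    integrable_of_measurable_of_abs_le ρ (hg.pow_const 2) (B := Bg ^ 2) fun x => by
      rw [abs_pow]; exact pow_le_pow_left₀ (abs_nonneg _) (hBg x) 2
  have iφg : Integrable (fun x => φ x * g x) ρ :=
    integrable_of_measurable_of_abs_le ρ (hφ.mul hg) (B := Bφ * Bg) (abs_mul_le_of_abs_le hBφ hBg)
  have key : ∀ t : ℝ, 0 ≤ (∫ x, φ x ^ 2 ∂ρ) * (t * t) + (-2 * ∫ x, φ x * g x ∂ρ) * t + ∫ x, g x ^ 2 ∂ρ := by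
    intro t
    have h0 : 0 ≤ ∫ x, (t * φ x - g x) ^ 2 ∂ρ := integral_nonneg fun x => sq_nonneg _
    have he : ∫ x, (t * φ x - g x) ^ 2 ∂ρ =
        (∫ x, φ x ^ 2 ∂ρ) * (t * t) + (-2 * ∫ x, φ x * g x ∂ρ) * t + ∫ x, g x ^ 2 ∂ρ := by
      have hfun : (fun x => (t * φ x - g x) ^ 2) =
          fun x => ((t * t) * φ x ^ 2 - (2 * t) * (φ x * g x)) + g x ^ 2 := by
        funext x; ring
      have i12 : Integrable (fun x => (t * t) * φ x ^ 2 - (2 * t) * (φ x * g x)) ρ := (iφ2.const_mul _).sub (iφg.const_mul _)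
      rw [hfun, integral_add i12 ig2, integral_sub (iφ2.const_mul _) (iφg.const_mul _), integral_const_mul, integral_const_mul]
      ring
    rw [← he]; exact h0
  have hd := discrim_le_zero key
  rw [discrim] at hd
  nlinarith [hd]

/-- **Jensen / Cauchy–Schwarz with `φ = 1`** on a probability space: `(∫ g dμ)² ≤ ∫ g² dμ`. [folklore] -/
theorem sq_integral_le_integral_sq (μ : Measure X) [IsProbabilityMeasure μ] {g : X → ℝ} (hg : Measurable g) {Bg : ℝ}
    (hBg : ∀ x, |g x| ≤ Bg) : (∫ x, g x ∂μ) ^ 2 ≤ ∫ x, g x ^ 2 ∂μ := by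
  have h := sq_integral_mul_le μ (measurable_const (a := (1 : ℝ))) (Bφ := 1) (fun _ => by simp) hg hBg
  simp only [one_mul, one_pow, integral_const, probReal_univ, smul_eq_mul, mul_one] at h
  simpa using h

/-! ## §2. Norm from form for the symmetric Feynman–Kac sandwich `S f = w · P(w f)` -/

/-- Expansion of `∫ (α − tβ)(γ − tδ) dρ` for bounded measurable `α, β, γ, δ`. [folklore] -/
theorem integral_sub_mul_sub_mul_expand (ρ : Measure X) [IsFiniteMeasure ρ] {α β γ δ : X → ℝ}
    (hα : Measurable α) {A : ℝ} (hA : ∀ x, |α x| ≤ A) (hβ : Measurable β) {B : ℝ} (hB : ∀ x, |β x| ≤ B)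
    (hγ : Measurable γ) {C : ℝ} (hC : ∀ x, |γ x| ≤ C) (hδ : Measurable δ) {D : ℝ} (hD : ∀ x, |δ x| ≤ D) (t : ℝ) :
    ∫ x, (α x - t * β x) * (γ x - t * δ x) ∂ρ =
      (∫ x, α x * γ x ∂ρ) - t * (∫ x, α x * δ x ∂ρ) - t * (∫ x, β x * γ x ∂ρ) + t * t * ∫ x, β x * δ x ∂ρ := by
  have i1 : Integrable (fun x => α x * γ x) ρ := integrable_of_measurable_of_abs_le ρ (hα.mul hγ) (abs_mul_le_of_abs_le hA hC)
  have i2 : Integrable (fun x => α x * δ x) ρ := integrable_of_measurable_of_abs_le ρ (hα.mul hδ) (abs_mul_le_of_abs_le hA hD)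
  have i3 : Integrable (fun x => β x * γ x) ρ := integrable_of_measurable_of_abs_le ρ (hβ.mul hγ) (abs_mul_le_of_abs_le hB hC)
  have i4 : Integrable (fun x => β x * δ x) ρ := integrable_of_measurable_of_abs_le ρ (hβ.mul hδ) (abs_mul_le_of_abs_le hB hD)
  have hfun : (fun x => (α x - t * β x) * (γ x - t * δ x)) =
      fun x => ((α x * γ x - t * (α x * δ x)) - t * (β x * γ x)) + (t * t) * (β x * δ x) := by
    funext x; ring
  have i12 : Integrable (fun x => α x * γ x - t * (α x * δ x)) ρ := i1.sub (i2.const_mul _)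
  have i123 : Integrable (fun x => (α x * γ x - t * (α x * δ x)) - t * (β x * γ x)) ρ := i12.sub (i3.const_mul _)
  rw [hfun, integral_add i123 (i4.const_mul _), integral_sub i12 (i3.const_mul _), integral_sub i1 (i2.const_mul _),
    integral_const_mul, integral_const_mul, integral_const_mul]

/-- ★★ **NORM FROM FORM for the symmetric sandwich `S f = w · P(w f)`.**  Let `P` be a Markov kernel on `X`, symmetric
(`∫ f·Pg dμ = ∫ g·Pf dμ`) and positive (`∫ g·Pg dμ ≥ 0`) on bounded measurable functions for the finite measure `μ`, and `w` a
bounded measurable weight.  If the quadratic form satisfies `∫ (wg)·P(wg) dμ ≤ m ∫ g² dμ` for all bounded measurable `g` (`m ≥ 0`),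
then `∫ (w·P(wf))² dμ ≤ m² ∫ f² dμ` for all bounded measurable `f`: the `L²` operator norm of a positive symmetric operator is the
top of its quadratic form — proved by Cauchy–Schwarz for the form `(u,v) ↦ ∫ (wu)·P(wv) dμ` at `(Sf, f)`, no spectral theory.
[cite: Lezaud2001, §4 (perturbation of a self-adjoint semigroup with spectral gap; proof of Theorem 1.1)] -/
theorem integral_sq_sandwich_le (μ : Measure X) [IsFiniteMeasure μ] (P : Kernel X X) [IsMarkovKernel P]
    (hSym : ∀ {f g : X → ℝ}, Measurable f → (∃ C : ℝ, ∀ x, |f x| ≤ C) → Measurable g → (∃ C : ℝ, ∀ x, |g x| ≤ C) →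
      ∫ x, f x * (∫ y, g y ∂(P x)) ∂μ = ∫ x, g x * (∫ y, f y ∂(P x)) ∂μ)
    (hPos : ∀ {g : X → ℝ}, Measurable g → (∃ C : ℝ, ∀ x, |g x| ≤ C) → 0 ≤ ∫ x, g x * (∫ y, g y ∂(P x)) ∂μ)
    {w : X → ℝ} (hw : Measurable w) {W : ℝ} (hwW : ∀ x, |w x| ≤ W) {m : ℝ} (hm : 0 ≤ m)
    (hForm : ∀ {g : X → ℝ}, Measurable g → (∃ C : ℝ, ∀ x, |g x| ≤ C) →
      ∫ x, (w x * g x) * (∫ y, w y * g y ∂(P x)) ∂μ ≤ m * ∫ x, g x ^ 2 ∂μ)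
    {f : X → ℝ} (hf : Measurable f) {C : ℝ} (hfC : ∀ x, |f x| ≤ C) :
    ∫ x, (w x * ∫ y, w y * f y ∂(P x)) ^ 2 ∂μ ≤ m ^ 2 * ∫ x, f x ^ 2 ∂μ := by
  -- the kernel actions `I_f = P(w f)` and `u = S f = w · I_f`
  have hwf : Measurable fun y => w y * f y := hw.mul hf
  have hwfb : ∀ y, |w y * f y| ≤ W * C := abs_mul_le_of_abs_le hwW hfC
  set If : X → ℝ := fun x => ∫ y, w y * f y ∂(P x) with hIf
  have hIfm : Measurable If := measurable_kernel_integral P hwf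
  have hIfb : ∀ x, |If x| ≤ W * C := fun x => abs_kernel_integral_le P hwfb x
  set u : X → ℝ := fun x => w x * If x with hu
  have hum : Measurable u := hw.mul hIfm
  have hub : ∀ x, |u x| ≤ W * (W * C) := abs_mul_le_of_abs_le hwW hIfb
  have hwu : Measurable fun y => w y * u y := hw.mul hum
  have hwub : ∀ y, |w y * u y| ≤ W * (W * (W * C)) := abs_mul_le_of_abs_le hwW hub
  set Iu : X → ℝ := fun x => ∫ y, w y * u y ∂(P x) with hIu
  have hIum : Measurable Iu := measurable_kernel_integral P hwu
  have hIub : ∀ x, |Iu x| ≤ W * (W * (W * C)) := fun x => abs_kernel_integral_le P hwub x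
  -- the three values of the form
  set N : ℝ := ∫ x, u x ^ 2 ∂μ with hN
  set Bff : ℝ := ∫ x, (w x * f x) * If x ∂μ with hBff
  set Buu : ℝ := ∫ x, (w x * u x) * Iu x ∂μ with hBuu
  have hN0 : 0 ≤ N := integral_nonneg fun x => sq_nonneg _
  have hNform : ∫ x, (w x * u x) * If x ∂μ = N := by
    rw [hN]; exact integral_congr_ae (ae_of_all _ fun x => by simp only [hu]; ring)
  -- symmetry: `∫ (w f) · P(w u) = ∫ (w u) · P(w f) = N`
  have hsym : ∫ x, (w x * f x) * Iu x ∂μ = N := by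
    have h : ∫ x, (w x * f x) * Iu x ∂μ = ∫ x, (w x * u x) * If x ∂μ := hSym hwf ⟨_, hwfb⟩ hwu ⟨_, hwub⟩
    rw [h, hNform]
  -- positivity of the form along the line `u − t f`
  have key : ∀ t : ℝ, 0 ≤ Bff * (t * t) + (-2 * N) * t + Buu := by
    intro t
    have hgt : Measurable fun x => u x - t * f x := hum.sub (hf.const_mul t)
    have hgtb : ∀ x, |u x - t * f x| ≤ W * (W * C) + |t| * C := fun x =>
      (abs_sub _ _).trans (add_le_add (hub x) (by rw [abs_mul]; exact mul_le_mul_of_nonneg_left (hfC x) (abs_nonneg _)))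
    have hpos := hPos (g := fun x => w x * (u x - t * f x)) (hw.mul hgt) ⟨W * (W * (W * C) + |t| * C), abs_mul_le_of_abs_le hwW hgtb⟩
    -- the kernel action is linear
    have hlin : ∀ x, ∫ y, w y * (u y - t * f y) ∂(P x) = Iu x - t * If x := by
      intro x
      have i1 : Integrable (fun y => w y * u y) (P x) := integrable_of_measurable_of_abs_le (P x) hwu hwub
      have i2 : Integrable (fun y => w y * f y) (P x) := integrable_of_measurable_of_abs_le (P x) hwf hwfb
      have hfun : (fun y => w y * (u y - t * f y)) = fun y => w y * u y - t * (w y * f y) := by funext y; ring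
      rw [hfun, integral_sub i1 (i2.const_mul t), integral_const_mul]
    have hexp : ∫ x, (w x * (u x - t * f x)) * (∫ y, w y * (u y - t * f y) ∂(P x)) ∂μ =
        Bff * (t * t) + (-2 * N) * t + Buu := by
      have h1 : ∫ x, (w x * (u x - t * f x)) * (∫ y, w y * (u y - t * f y) ∂(P x)) ∂μ =
          ∫ x, (w x * u x - t * (w x * f x)) * (Iu x - t * If x) ∂μ :=
        integral_congr_ae (ae_of_all _ fun x => by simp only [hlin x]; ring)
      have hx : ∫ x, (w x * u x - t * (w x * f x)) * (Iu x - t * If x) ∂μ =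
          (∫ x, (w x * u x) * Iu x ∂μ) - t * (∫ x, (w x * u x) * If x ∂μ) - t * (∫ x, (w x * f x) * Iu x ∂μ) +
            t * t * ∫ x, (w x * f x) * If x ∂μ :=
        integral_sub_mul_sub_mul_expand μ hwu hwub hwf hwfb hIum hIub hIfm hIfb t
      rw [h1, hx, hNform, hsym, hBff, hBuu]
      ring
    rw [← hexp]; exact hpos
  have hd := discrim_le_zero key
  rw [discrim] at hd
  -- `N² ≤ Bff · Buu ≤ (m ∫f²)(m N)`
  have hBff : Bff ≤ m * ∫ x, f x ^ 2 ∂μ := hForm hf ⟨C, hfC⟩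
  have hBuu : Buu ≤ m * N := by rw [hN]; exact hForm hum ⟨_, hub⟩
  have hBff0 : 0 ≤ Bff := hPos hwf ⟨_, hwfb⟩
  have hBuu0 : 0 ≤ Buu := hPos hwu ⟨_, hwub⟩
  have hf2 : 0 ≤ ∫ x, f x ^ 2 ∂μ := integral_nonneg fun x => sq_nonneg _
  have hNN : N * N ≤ (m * ∫ x, f x ^ 2 ∂μ) * (m * N) := by
    have h1 : N * N ≤ Bff * Buu := by nlinarith [hd]
    exact h1.trans (mul_le_mul hBff hBuu hBuu0 (mul_nonneg hm hf2))
  have hgoal : N ≤ m ^ 2 * ∫ x, f x ^ 2 ∂μ := by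
    rcases hN0.lt_or_eq with hpos | hzero
    · have h2 : N * N ≤ (m ^ 2 * ∫ x, f x ^ 2 ∂μ) * N := by
        calc N * N ≤ (m * ∫ x, f x ^ 2 ∂μ) * (m * N) := hNN
          _ = (m ^ 2 * ∫ x, f x ^ 2 ∂μ) * N := by ring
      exact le_of_mul_le_mul_right h2 hpos
    · rw [← hzero]; exact mul_nonneg (sq_nonneg m) hf2
  simpa [hN, hu, hIf] using hgoal

/-! ## §3. Iterates of the sandwich -/

/-- The iterates `Sᵏ f` of the sandwich `S φ = w · P(w φ)` (`|w| ≤ W`, `|f| ≤ C`) are measurable with `|Sᵏ f| ≤ (W·W)ᵏ C`. [folklore] -/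
theorem sandwich_iterate_measurable_abs_le (P : Kernel X X) [IsMarkovKernel P] {w : X → ℝ} (hw : Measurable w) {W : ℝ}
    (hwW : ∀ x, |w x| ≤ W) {f : X → ℝ} (hf : Measurable f) {C : ℝ} (hfC : ∀ x, |f x| ≤ C) (k : ℕ) :
    Measurable ((fun (φ : X → ℝ) (x : X) => w x * ∫ y, w y * φ y ∂(P x))^[k] f) ∧
      ∀ x, |((fun (φ : X → ℝ) (x : X) => w x * ∫ y, w y * φ y ∂(P x))^[k] f) x| ≤ (W * W) ^ k * C := by
  induction k with
  | zero => exact ⟨by simpa using hf, fun x => by simpa using hfC x⟩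
  | succ k ih =>
    obtain ⟨hmk, hbk⟩ := ih
    refine ⟨?_, fun x => ?_⟩
    · rw [Function.iterate_succ_apply']
      exact hw.mul (measurable_kernel_integral P (hw.mul hmk))
    · rw [Function.iterate_succ_apply']
      have hin : ∀ y, |w y * ((fun (φ : X → ℝ) (x : X) => w x * ∫ y, w y * φ y ∂(P x))^[k] f) y| ≤ W * ((W * W) ^ k * C) :=
        abs_mul_le_of_abs_le hwW hbk
      calc |w x * ∫ y, w y * ((fun (φ : X → ℝ) (x : X) => w x * ∫ y, w y * φ y ∂(P x))^[k] f) y ∂(P x)|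
          ≤ W * (W * ((W * W) ^ k * C)) := abs_mul_le_of_abs_le hwW (fun x => abs_kernel_integral_le P hin x) x
        _ = (W * W) ^ (k + 1) * C := by ring

/-- ★★ **`∫ (Sᵏ f)² dμ ≤ m^{2k} ∫ f² dμ`** for the symmetric positive sandwich `S φ = w · P(w φ)` whose form is bounded by `m`
(iterate `integral_sq_sandwich_le`). [cite: Lezaud2001, §4 (proof of Theorem 1.1)] -/
theorem integral_sq_sandwich_iterate_le (μ : Measure X) [IsFiniteMeasure μ] (P : Kernel X X) [IsMarkovKernel P]
    (hSym : ∀ {f g : X → ℝ}, Measurable f → (∃ C : ℝ, ∀ x, |f x| ≤ C) → Measurable g → (∃ C : ℝ, ∀ x, |g x| ≤ C) →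
      ∫ x, f x * (∫ y, g y ∂(P x)) ∂μ = ∫ x, g x * (∫ y, f y ∂(P x)) ∂μ)
    (hPos : ∀ {g : X → ℝ}, Measurable g → (∃ C : ℝ, ∀ x, |g x| ≤ C) → 0 ≤ ∫ x, g x * (∫ y, g y ∂(P x)) ∂μ)
    {w : X → ℝ} (hw : Measurable w) {W : ℝ} (hwW : ∀ x, |w x| ≤ W) {m : ℝ} (hm : 0 ≤ m)
    (hForm : ∀ {g : X → ℝ}, Measurable g → (∃ C : ℝ, ∀ x, |g x| ≤ C) →
      ∫ x, (w x * g x) * (∫ y, w y * g y ∂(P x)) ∂μ ≤ m * ∫ x, g x ^ 2 ∂μ)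
    {f : X → ℝ} (hf : Measurable f) {C : ℝ} (hfC : ∀ x, |f x| ≤ C) (k : ℕ) :
    ∫ x, (((fun (φ : X → ℝ) (x : X) => w x * ∫ y, w y * φ y ∂(P x))^[k] f) x) ^ 2 ∂μ ≤ m ^ (2 * k) * ∫ x, f x ^ 2 ∂μ := by
  induction k with
  | zero => simp
  | succ k ih =>
    obtain ⟨hmk, hbk⟩ := sandwich_iterate_measurable_abs_le P hw hwW hf hfC k
    have hstep := integral_sq_sandwich_le μ P hSym hPos hw hwW hm hForm hmk hbk
    have hf2 : 0 ≤ ∫ x, f x ^ 2 ∂μ := integral_nonneg fun x => sq_nonneg _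
    calc ∫ x, (((fun (φ : X → ℝ) (x : X) => w x * ∫ y, w y * φ y ∂(P x))^[k + 1] f) x) ^ 2 ∂μ
        = ∫ x, (w x * ∫ y, w y * ((fun (φ : X → ℝ) (x : X) => w x * ∫ y, w y * φ y ∂(P x))^[k] f) y ∂(P x)) ^ 2 ∂μ := by
          refine integral_congr_ae (ae_of_all _ fun x => ?_)
          rw [Function.iterate_succ_apply']
      _ ≤ m ^ 2 * ∫ x, (((fun (φ : X → ℝ) (x : X) => w x * ∫ y, w y * φ y ∂(P x))^[k] f) x) ^ 2 ∂μ := hstep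
      _ ≤ m ^ 2 * (m ^ (2 * k) * ∫ x, f x ^ 2 ∂μ) := mul_le_mul_of_nonneg_left ih (by positivity)
      _ = m ^ (2 * (k + 1)) * ∫ x, f x ^ 2 ∂μ := by ring

end Summit.QuantumFields.YangMills.Theorems.ColdStartUniversality.FeynmanKac

end
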